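import Summits.KontsevichZagierPeriods.Zeta5Search.Zudilin2002IntegralityTwoAdic
import Summits.KontsevichZagierPeriods.Zeta5Search.Zudilin2002Contiguity
import HarnessLib

/-!
# Zudilin 2002's integrality `4D_n²qₙ, 4D_n⁷pₙ, 4D_n⁵p̃ₙ ∈ ℤ`: the partner half is free (contiguity transport), and the
named fact follows from Krattenthaler–Rivoal's Théorème 1 (cell `pub-zeta5`, seat ct-1 g40)

HONEST FRAMING: systematic search; no irrationality claim unless certified.  `2`-adic bookkeeping of the six
coefficient sequences `uₙ, wₙ, vₙ` (of Zudilin's very-well-poised form `rₙ = uₙζ(5) + wₙζ(3) − vₙ`) and `ũₙ, w̃ₙ, ṽₙ`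
(of the partner form `r̃ₙ`), Mat. Zametki **72** (2002) 796–800, §2 (7), (14), (15); nothing here concerns the
arithmetic nature of `ζ(5)` or `ζ(3)`; records in print UNMOVED.  NOTHING IS DISCHARGED UNCONDITIONALLY: the named
Literature fact `Zudilin2002.integrality` becomes a COROLLARY of the named Literature fact
`KrattenthalerRivoal2007.theoreme1` (a theorem in print, Mem. AMS 875 (2007), not proved in the tree) — net debt 0.

OUR work (Summit side), sequel of `Zudilin2002IntegralityTwoAdic` (seat ct-1 g39), which proved
`integrality ↔ ∀ n ≥ 1, ord₂(D_n⁷pₙ) ≥ −2 ∧ ord₂(D_n⁵p̃ₙ) ≥ −2` and reduced the right-hand side to SIX `2`-adic bounds,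
three on the `r`-half `(u, w, v)` and three on the partner half `(ũ, w̃, ṽ)` (`integrality_of_coeffs`).  This file removes
the partner half:

* `exp_neg_one_le_padicValuation_Q0` — the leading coefficient `b₀(n) = 41218n³ + 48459n² + 20010n + 2871` of the
  cell's kernel-certified PARTNER CONTIGUITY `b₀(n)x̃ₙ = −196n⁵xₙ₋₁ + c_B(n)xₙ − 87(n+1)⁵xₙ₊₁`
  (`Zudilin2002Minors.contig_uC/wC/vC`, file `Zudilin2002Contiguity`) is NEVER divisible by `4`
  (`b₀(n) ≡ 3 (mod 4)` for even `n`, `≡ 2 (mod 4)` for odd `n`): `ord₂ b₀(n) ≤ 1`;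
* `transport` — hence a `2`-adic bound `ord₂(D_m^k x_m) ≥ −M` for ALL `m` (`k ≤ 5`) transports along the contiguity to
  `ord₂(D_n^k x̃ₙ) ≥ −M − 1` for all `n ≥ 1` (the factors `n⁵`, `(n+1)⁵` absorb the change of `D_{n∓1}` to `D_n`);
* `two_adic_of_coeffs'` — the determinant step (15) with the LOPSIDED exponents this produces:
  `ord₂(u, D²w, D⁵v) ≥ (0, 0, −1)` and `ord₂(ũ, D²w̃, D⁵ṽ) ≥ (−1, −1, −2)` still give `ord₂(D⁷p), ord₂(D⁵p̃) ≥ −2`;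
* **`integrality_of_rHalf_two_adic`** — `Zudilin2002.integrality` follows from THREE `2`-adic bounds on the `r`-series
  alone: `∀ n, ord₂(uₙ) ≥ 0 ∧ ord₂(D_n²wₙ) ≥ 0 ∧ ord₂(D_n⁵vₙ) ≥ −1`; equivalently (`integrality_of_rHalf_int`, the odd primes
  being the tree's `BrickDenominators.padicValuation_uC_le` …) from `uₙ ∈ ℤ ∧ D_n²wₙ ∈ ℤ ∧ 2D_n⁵vₙ ∈ ℤ` for all `n`;
* `rHalf_int_of_theoreme1` — these three inclusions ARE Krattenthaler–Rivoal's Théorème 1 (i) (`l = 5, 3`) and (ii) (`C = 0`)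
  at `(n, A, B, C, r) = (n, 6, 1, 0, 1)`, `z = (−1)^6 = 1`, read on the tree's cells of the kernel `(6,1,1)` (which ARE their
  partial-fraction data, `BrickDenominators.isPartialFractionData_cell`, with `p_{l,n}(1) = x_l(n)`, `p_{0,0,n}(1) = x_0(n)` and
  `uₙ = x_5(n)`, `wₙ = x_3(n)`, `vₙ = −x_0(n)`, `BrickLinearForms`);
* **`integrality_of_theoreme1 : KrattenthalerRivoal2007.theoreme1 → Zudilin2002.integrality`** (CONDITIONAL result).

So the `2`-adic residual isolated by ct-1 g39 is exactly the prime-`2` content of Krattenthaler–Rivoal's saving of one `d_n`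
for the ONE kernel `(6,1,1)` (`x_5, x_3 ∈ d_n^{0,−2}ℤ₍₂₎`, `2x_0 ∈ d_n^{−5}ℤ₍₂₎`); the partner series needs no arithmetic of
its own.  In print Zudilin obtains (14) for BOTH series from Vasilyev's integrals and his integral identity; the route here
(contiguity transport) is the cell's.  DATA (seat desk, exact, `n ≤ 12`, not used by the kernel): `ord₂ b₀(n) = 0, 1, 0, 1, …` (`n = 0, 1, 2, …`);
`ord₂(uₙ) = ord₂(D_n²wₙ) = ord₂(D_n⁵vₙ) = 0`; the transported partner bounds hold with room to spare and are tight only at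
`n = 1` (`ord₂(D₁⁵ṽ₁) = −1`).
-/

noncomputable section

open WithZero

namespace Summit.KontsevichZagierPeriods.Zeta5Search.Zudilin2002IntegralityFromKR

open Literature.NumberTheory.Irrationality
open Literature.NumberTheory.Irrationality.Zudilin2002 (q p ptilde uC wC vC utC wtC vtC minorP minorPt integrality)
open Literature.NumberTheory.Irrationality.KrattenthalerRivoal2007 (theoreme1)
open Summit.KontsevichZagierPeriods.Zeta5Search.Zudilin2002Minors (Contig Q0 QA QB QC b₀_eq contig_uC contig_wC
  contig_vC)
open Summit.KontsevichZagierPeriods.Zeta5Search.BrickDenominators (isPartialFractionData_cell pCoeff_one_eq_xCoeff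
  pZero_one_eq_xZero le_exp_of_pow_mul_le padicValuation_uC_le padicValuation_lcmUpto_sq_mul_wC_le
  padicValuation_lcmUpto_pow_five_mul_vC_le)
open Summit.KontsevichZagierPeriods.Zeta5Search.BrickLinearForms (uC_eq_xCoeff wC_eq_xCoeff vC_eq_neg_xZero)
open Summit.KontsevichZagierPeriods.Zeta5Search.Zudilin2002IntegralityTwoAdic (integrality_iff_two_adic
  padicValuation_intCast_le_one exists_int_of_forall_padicValuation_le_one)

/-! ### Bookkeeping: `D_n = lcm(1,…,n)` under `n ↦ n ± 1` -/

/-- `D_m ∣ D_{m+1}`. [folklore] -/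
private theorem lcmUpto_dvd_succ (m : ℕ) : Nat.lcmUpto m ∣ Nat.lcmUpto (m + 1) := by
  unfold Nat.lcmUpto
  exact Finset.lcm_dvd fun i hi => Finset.dvd_lcm (by
    have := Finset.mem_Icc.1 hi; exact Finset.mem_Icc.2 ⟨this.1, this.2.trans (Nat.le_succ m)⟩)

/-- `D_{m+1} ∣ D_m · (m+1)`. [folklore] -/
private theorem lcmUpto_succ_dvd_mul (m : ℕ) : Nat.lcmUpto (m + 1) ∣ Nat.lcmUpto m * (m + 1) := by
  unfold Nat.lcmUpto
  refine Finset.lcm_dvd fun i hi => ?_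
  have h := Finset.mem_Icc.1 hi
  rcases Nat.lt_or_ge i (m + 1) with hlt | hge
  · exact Dvd.dvd.mul_right (Finset.dvd_lcm (Finset.mem_Icc.2 ⟨h.1, Nat.lt_succ_iff.1 hlt⟩)) _
  · have : i = m + 1 := le_antisymm h.2 hge
    subst this
    exact Dvd.intro_left _ rfl

/-! ### The leading coefficient of the contiguity is never divisible by `4` -/

/-- **`ord₂ b₀(n) ≤ 1`**: the leading coefficient `Q0 m = b₀(m+1) = 41218n³ + 48459n² + 20010n + 2871` (`n = m+1`) of the
cell's partner contiguity satisfies `b₀(n) ≡ 2n³ + 3n² + 2n + 3 ≢ 0 (mod 4)`, so `v₂(b₀(n)) ≥ exp(−1)`. -/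
theorem exp_neg_one_le_padicValuation_Q0 (m : ℕ) : exp (-1) ≤ Rat.padicValuation 2 (Q0 m) := by
  set B : ℤ := 41218 * ((m : ℤ) + 1) ^ 3 + 48459 * ((m : ℤ) + 1) ^ 2 + 20010 * ((m : ℤ) + 1) + 2871 with hB
  have hQ : Q0 m = (B : ℚ) := by
    simp only [Q0, b₀_eq, hB]; push_cast; ring
  have h4 : ¬ (4 : ℤ) ∣ B := by
    intro h
    have hdec : ∀ x : ZMod 4, (2 : ZMod 4) * (x + 1) ^ 3 + 3 * (x + 1) ^ 2 + 2 * (x + 1) + 3 ≠ 0 := by decide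
    have hcast : ((B : ℤ) : ZMod 4) = (2 : ZMod 4) * ((m : ZMod 4) + 1) ^ 3 + 3 * ((m : ZMod 4) + 1) ^ 2 +
        2 * ((m : ZMod 4) + 1) + 3 := by
      have e1 : (41218 : ZMod 4) = 2 := by decide
      have e2 : (48459 : ZMod 4) = 3 := by decide
      have e3 : (20010 : ZMod 4) = 2 := by decide
      have e4 : (2871 : ZMod 4) = 3 := by decide
      rw [hB]; push_cast; rw [e1, e2, e3, e4]
    have h0 : ((B : ℤ) : ZMod 4) = 0 := (ZMod.intCast_zmod_eq_zero_iff_dvd B 4).2 h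
    exact hdec (m : ZMod 4) (hcast ▸ h0)
  have hle : exp (-1 : ℤ) ≤ (1 : ℤᵐ⁰) := by rw [← exp_zero]; exact exp_le_exp.2 (by norm_num)
  rw [hQ, Rat.padicValuation_cast]
  by_cases h2 : (2 : ℤ) ∣ B
  · obtain ⟨C, hC⟩ := h2
    have hC2 : ¬ ((2 : ℕ) : ℤ) ∣ C := fun ⟨E, hE⟩ => h4 ⟨E, by rw [hC, hE]; ring⟩
    rw [hC, map_mul, show (2 : ℤ) = ((2 : ℕ) : ℤ) from rfl, Int.padicValuation_self,
      Int.padicValuation_eq_one_iff.2 hC2, mul_one]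
  · have h2' : ¬ ((2 : ℕ) : ℤ) ∣ B := by exact_mod_cast h2
    rw [Int.padicValuation_eq_one_iff.2 h2']
    exact hle

/-! ### Transport of `2`-adic bounds along the partner contiguity -/

/-- **Transport.**  If `x, x̃` satisfy the cell's partner contiguity (`Contig x x̃`: `b₀(n)x̃ₙ = −196n⁵xₙ₋₁ + c_B(n)xₙ −
87(n+1)⁵xₙ₊₁`, `n ≥ 1`), `k ≤ 5`, and `ord₂(D_m^k x_m) ≥ −M` for every `m`, then `ord₂(D_n^k x̃ₙ) ≥ −M − 1` for every
`n ≥ 1`.  (`D_n^k·n⁵xₙ₋₁ = n⁵(D_n/D_{n−1})^k·D_{n−1}^k xₙ₋₁` and `D_n^k(n+1)⁵xₙ₊₁ = (n+1)^{5−k}b^k·D_{n+1}^k xₙ₊₁` with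
`D_n(n+1) = D_{n+1}b`; one factor `2` is lost in `b₀(n)`.) -/
theorem transport {x xt : ℕ → ℚ} (hC : Contig x xt) {k : ℕ} (hk : k ≤ 5) {M : ℤ}
    (hx : ∀ m : ℕ, Rat.padicValuation 2 ((Nat.lcmUpto m : ℚ) ^ k * x m) ≤ exp M) {n : ℕ} (hn : 1 ≤ n) :
    Rat.padicValuation 2 ((Nat.lcmUpto n : ℚ) ^ k * xt n) ≤ exp (M + 1) := by
  obtain ⟨m, rfl⟩ : ∃ m, n = m + 1 := ⟨n - 1, by omega⟩
  obtain ⟨a, ha⟩ := lcmUpto_dvd_succ m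
  obtain ⟨b, hb⟩ := lcmUpto_succ_dvd_mul (m + 1)
  set D : ℚ := (Nat.lcmUpto (m + 1) : ℚ) with hD
  have haQ : D = (Nat.lcmUpto m : ℚ) * (a : ℚ) := by rw [hD, ha]; push_cast; ring
  have hbQ : D * ((m : ℚ) + 2) = (Nat.lcmUpto (m + 2) : ℚ) * (b : ℚ) := by
    have := congrArg (fun z : ℕ => (z : ℚ)) hb
    push_cast at this
    rw [hD, ← this]; ring
  -- the contiguity, multiplied by `D^k`, with the three terms in transported form
  have key : Q0 m * (D ^ k * xt (m + 1)) =
      QA m * (a : ℚ) ^ k * ((Nat.lcmUpto m : ℚ) ^ k * x m) + QB m * (D ^ k * x (m + 1)) +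
        (-87) * ((m : ℚ) + 2) ^ (5 - k) * (b : ℚ) ^ k * ((Nat.lcmUpto (m + 2) : ℚ) ^ k * x (m + 2)) := by
    have h5 : ((m : ℚ) + 2) ^ 5 = ((m : ℚ) + 2) ^ (5 - k) * ((m : ℚ) + 2) ^ k := by
      rw [← pow_add, Nat.sub_add_cancel hk]
    have e3 : QC m * x (m + 2) * D ^ k =
        (-87) * ((m : ℚ) + 2) ^ (5 - k) * (b : ℚ) ^ k * ((Nat.lcmUpto (m + 2) : ℚ) ^ k * x (m + 2)) := by
      rw [QC, show ((m : ℚ) + 2) = ((m : ℚ) + 2) from rfl, h5]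
      have : (D * ((m : ℚ) + 2)) ^ k = ((Nat.lcmUpto (m + 2) : ℚ)) ^ k * (b : ℚ) ^ k := by rw [hbQ, mul_pow]
      calc -87 * (((m : ℚ) + 2) ^ (5 - k) * ((m : ℚ) + 2) ^ k) * x (m + 2) * D ^ k
          = -87 * ((m : ℚ) + 2) ^ (5 - k) * (D * ((m : ℚ) + 2)) ^ k * x (m + 2) := by rw [mul_pow]; ring
        _ = _ := by rw [this]; ring
    have e1 : QA m * x m * D ^ k = QA m * (a : ℚ) ^ k * ((Nat.lcmUpto m : ℚ) ^ k * x m) := by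
      rw [haQ, mul_pow]; ring
    calc Q0 m * (D ^ k * xt (m + 1)) = (Q0 m * xt (m + 1)) * D ^ k := by ring
      _ = (QA m * x m + QB m * x (m + 1) + QC m * x (m + 2)) * D ^ k := by rw [hC m]
      _ = QA m * x m * D ^ k + QB m * (D ^ k * x (m + 1)) + QC m * x (m + 2) * D ^ k := by
          have : (((m + 2 : ℕ) : ℚ)) = (m : ℚ) + 2 := by push_cast; ring
          ring
      _ = _ := by rw [e1, e3]
  -- valuations of the three terms
  have hQA : Rat.padicValuation 2 (QA m * (a : ℚ) ^ k) ≤ 1 := by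
    rw [QA, show (-196 : ℚ) * ((m : ℚ) + 1) ^ 5 * (a : ℚ) ^ k = (((-196) * ((m : ℤ) + 1) ^ 5 * (a : ℤ) ^ k : ℤ) : ℚ) by
      push_cast; ring]
    exact padicValuation_intCast_le_one 2 _
  have hQB : Rat.padicValuation 2 (QB m) ≤ 1 := by
    rw [QB, show (3 : ℚ) * (10130 * ((m : ℚ) + 1) ^ 5 + 19198 * ((m : ℚ) + 1) ^ 4 + 16675 * ((m : ℚ) + 1) ^ 3 +
        8207 * ((m : ℚ) + 1) ^ 2 + 2233 * ((m : ℚ) + 1) + 261) = ((3 * (10130 * ((m : ℤ) + 1) ^ 5 +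
        19198 * ((m : ℤ) + 1) ^ 4 + 16675 * ((m : ℤ) + 1) ^ 3 + 8207 * ((m : ℤ) + 1) ^ 2 + 2233 * ((m : ℤ) + 1) + 261) : ℤ) : ℚ)
        by push_cast; ring]
    exact padicValuation_intCast_le_one 2 _
  have hQC : Rat.padicValuation 2 ((-87) * ((m : ℚ) + 2) ^ (5 - k) * (b : ℚ) ^ k) ≤ 1 := by
    rw [show (-87 : ℚ) * ((m : ℚ) + 2) ^ (5 - k) * (b : ℚ) ^ k = (((-87) * ((m : ℤ) + 2) ^ (5 - k) * (b : ℤ) ^ k : ℤ) : ℚ)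
      by push_cast; ring]
    exact padicValuation_intCast_le_one 2 _
  have h1 := hx m
  have h2 := hx (m + 1)
  have h3 := hx (m + 2)
  rw [← hD] at h2
  have hsum : Rat.padicValuation 2 (Q0 m * (D ^ k * xt (m + 1))) ≤ exp M := by
    rw [key]
    refine (Valuation.map_add _ _ _).trans (max_le ((Valuation.map_add _ _ _).trans (max_le ?_ ?_)) ?_)
    · rw [map_mul]; simpa only [one_mul] using mul_le_mul' hQA h1
    · rw [map_mul]; simpa only [one_mul] using mul_le_mul' hQB h2
    · rw [map_mul]; simpa only [one_mul] using mul_le_mul' hQC h3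
  rw [map_mul] at hsum
  have hQ0 := exp_neg_one_le_padicValuation_Q0 m
  calc Rat.padicValuation 2 (D ^ k * xt (m + 1))
      = exp (1 : ℤ) * (exp (-1 : ℤ) * Rat.padicValuation 2 (D ^ k * xt (m + 1))) := by
        rw [← mul_assoc, ← exp_add]; norm_num
    _ ≤ exp (1 : ℤ) * (Rat.padicValuation 2 (Q0 m) * Rat.padicValuation 2 (D ^ k * xt (m + 1))) :=
        mul_le_mul' le_rfl (mul_le_mul' hQ0 le_rfl)
    _ ≤ exp (1 : ℤ) * exp M := mul_le_mul' le_rfl hsum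
    _ = exp (M + 1) := by rw [← exp_add, add_comm]

/-- **The partner half is free**: `ord₂(uₘ) ≥ 0`, `ord₂(D_m²wₘ) ≥ 0`, `ord₂(D_m⁵vₘ) ≥ −1` for all `m` give, for every `n ≥ 1`,
`ord₂(ũₙ) ≥ −1`, `ord₂(D_n²w̃ₙ) ≥ −1`, `ord₂(D_n⁵ṽₙ) ≥ −2` — by `transport` along the three certified contiguities
`contig_uC`, `contig_wC`, `contig_vC`. -/
theorem partner_two_adic_of_rHalf
    (h : ∀ m : ℕ, Rat.padicValuation 2 (uC m) ≤ 1 ∧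
      Rat.padicValuation 2 ((Nat.lcmUpto m : ℚ) ^ 2 * wC m) ≤ 1 ∧
        Rat.padicValuation 2 ((Nat.lcmUpto m : ℚ) ^ 5 * vC m) ≤ exp 1)
    {n : ℕ} (hn : 1 ≤ n) :
    Rat.padicValuation 2 (utC n) ≤ exp 1 ∧
      Rat.padicValuation 2 ((Nat.lcmUpto n : ℚ) ^ 2 * wtC n) ≤ exp 1 ∧
        Rat.padicValuation 2 ((Nat.lcmUpto n : ℚ) ^ 5 * vtC n) ≤ exp 2 := by
  refine ⟨?_, ?_, ?_⟩
  · have hx : ∀ m : ℕ, Rat.padicValuation 2 ((Nat.lcmUpto m : ℚ) ^ 0 * uC m) ≤ exp 0 := fun m => by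
      rw [pow_zero, one_mul, exp_zero]; exact (h m).1
    have := transport contig_uC (by norm_num) hx hn
    rwa [pow_zero, one_mul, zero_add] at this
  · have hx : ∀ m : ℕ, Rat.padicValuation 2 ((Nat.lcmUpto m : ℚ) ^ 2 * wC m) ≤ exp 0 := fun m => by
      rw [exp_zero]; exact (h m).2.1
    have := transport contig_wC (by norm_num) hx hn
    rwa [zero_add] at this
  · have := transport contig_vC le_rfl (fun m => (h m).2.2) hn
    rwa [show (1 : ℤ) + 1 = 2 by norm_num] at this

/-! ### The determinant step (15) with lopsided exponents -/

/-- **(15) with lopsided `2`-adic exponents.**  `ord₂(uₙ) ≥ 0`, `ord₂(D_n²wₙ) ≥ 0`, `ord₂(D_n⁵vₙ) ≥ −1` and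
`ord₂(ũₙ) ≥ −1`, `ord₂(D_n²w̃ₙ) ≥ −1`, `ord₂(D_n⁵ṽₙ) ≥ −2` imply `ord₂(D_n⁷pₙ) ≥ −2` and `ord₂(D_n⁵p̃ₙ) ≥ −2`, by
`pₙ = w̃ₙvₙ − wₙṽₙ`, `p̃ₙ = uₙṽₙ − ũₙvₙ` (`SymRay.eq15`, proved in the tree): every product pairs a `0` with a `−2` or a `−1`
with a `−1`. -/
theorem two_adic_of_coeffs' (n : ℕ)
    (hu : Rat.padicValuation 2 (uC n) ≤ 1)
    (hw : Rat.padicValuation 2 ((Nat.lcmUpto n : ℚ) ^ 2 * wC n) ≤ 1)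
    (hv : Rat.padicValuation 2 ((Nat.lcmUpto n : ℚ) ^ 5 * vC n) ≤ exp 1)
    (hut : Rat.padicValuation 2 (utC n) ≤ exp 1)
    (hwt : Rat.padicValuation 2 ((Nat.lcmUpto n : ℚ) ^ 2 * wtC n) ≤ exp 1)
    (hvt : Rat.padicValuation 2 ((Nat.lcmUpto n : ℚ) ^ 5 * vtC n) ≤ exp 2) :
    Rat.padicValuation 2 ((Nat.lcmUpto n : ℚ) ^ 7 * p n) ≤ exp 2 ∧
      Rat.padicValuation 2 ((Nat.lcmUpto n : ℚ) ^ 5 * ptilde n) ≤ exp 2 := by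
  obtain ⟨-, hpp, hpt⟩ := SymRay.eq15 n
  have h11 : exp (1 : ℤ) * exp 1 = exp 2 := by rw [← exp_add]; norm_num
  have h02 : (1 : ℤᵐ⁰) * exp 2 = exp 2 := one_mul _
  set d : ℚ := (Nat.lcmUpto n : ℚ) with hd
  constructor
  · rw [hpp, minorP, show d ^ 7 * (wtC n * vC n - wC n * vtC n) =
        (d ^ 2 * wtC n) * (d ^ 5 * vC n) - (d ^ 2 * wC n) * (d ^ 5 * vtC n) by ring]
    refine (Valuation.map_sub _ _ _).trans (max_le ?_ ?_)
    · rw [map_mul, ← h11]; exact mul_le_mul' hwt hv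
    · rw [map_mul, ← h02]; exact mul_le_mul' hw hvt
  · rw [hpt, minorPt, show d ^ 5 * (uC n * vtC n - utC n * vC n) =
        uC n * (d ^ 5 * vtC n) - utC n * (d ^ 5 * vC n) by ring]
    refine (Valuation.map_sub _ _ _).trans (max_le ?_ ?_)
    · rw [map_mul, ← h02]; exact mul_le_mul' hu hvt
    · rw [map_mul, ← h11]; exact mul_le_mul' hut hv

/-! ### `Zudilin2002.integrality` from the `r`-half alone -/

/-- **`Zudilin2002.integrality` from three `2`-adic bounds on the `r`-series.**  If for every `n`
`ord₂(uₙ) ≥ 0`, `ord₂(D_n²wₙ) ≥ 0` and `ord₂(D_n⁵vₙ) ≥ −1` (the prime-`2` content of Krattenthaler–Rivoal's saving for the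
kernel `(6,1,1)`), then `4D_n²qₙ, 4D_n⁷pₙ, 4D_n⁵p̃ₙ ∈ ℤ` for all `n ≥ 1`: partner bounds by `partner_two_adic_of_rHalf`,
the `2`-adic residual by `two_adic_of_coeffs'`, odd primes and the `q`-conjunct by ct-1 g39's `integrality_iff_two_adic`.
[cite: Zudilin2002Zeta5, Sect. 1 (display before (6)) and Sect. 2 (14)–(15)] -/
theorem integrality_of_rHalf_two_adic
    (h : ∀ m : ℕ, Rat.padicValuation 2 (uC m) ≤ 1 ∧
      Rat.padicValuation 2 ((Nat.lcmUpto m : ℚ) ^ 2 * wC m) ≤ 1 ∧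
        Rat.padicValuation 2 ((Nat.lcmUpto m : ℚ) ^ 5 * vC m) ≤ exp 1) :
    integrality :=
  integrality_iff_two_adic.mpr fun n hn => by
    obtain ⟨hut, hwt, hvt⟩ := partner_two_adic_of_rHalf h hn
    exact two_adic_of_coeffs' n (h n).1 (h n).2.1 (h n).2.2 hut hwt hvt

/-- From `uₙ ∈ ℤ`, `D_n²wₙ ∈ ℤ`, `2D_n⁵vₙ ∈ ℤ` to the three `2`-adic bounds of `integrality_of_rHalf_two_adic`. [folklore] -/
theorem rHalf_two_adic_of_int {n : ℕ}
    (h : (∃ z : ℤ, uC n = z) ∧ (∃ z : ℤ, (Nat.lcmUpto n : ℚ) ^ 2 * wC n = z) ∧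
      (∃ z : ℤ, 2 * (Nat.lcmUpto n : ℚ) ^ 5 * vC n = z)) :
    Rat.padicValuation 2 (uC n) ≤ 1 ∧
      Rat.padicValuation 2 ((Nat.lcmUpto n : ℚ) ^ 2 * wC n) ≤ 1 ∧
        Rat.padicValuation 2 ((Nat.lcmUpto n : ℚ) ^ 5 * vC n) ≤ exp 1 := by
  obtain ⟨⟨z₁, hz₁⟩, ⟨z₂, hz₂⟩, ⟨z₃, hz₃⟩⟩ := h
  refine ⟨hz₁ ▸ padicValuation_intCast_le_one 2 z₁, hz₂ ▸ padicValuation_intCast_le_one 2 z₂, ?_⟩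
  have h' : Rat.padicValuation 2 (((2 : ℕ) : ℚ) ^ 1 * ((Nat.lcmUpto n : ℚ) ^ 5 * vC n)) ≤ exp (-(0 : ℤ)) := by
    rw [pow_one, Nat.cast_ofNat, ← mul_assoc, hz₃, neg_zero, exp_zero]
    exact padicValuation_intCast_le_one 2 z₃
  simpa using le_exp_of_pow_mul_le (p := 2) h'

/-- Conversely the three `2`-adic bounds give back the three inclusions, the odd primes being the tree's
`BrickDenominators.padicValuation_uC_le`, `…_lcmUpto_sq_mul_wC_le`, `…_lcmUpto_pow_five_mul_vC_le` (cell zeta5-irr). [folklore] -/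
theorem rHalf_int_of_two_adic {n : ℕ}
    (h : Rat.padicValuation 2 (uC n) ≤ 1 ∧
      Rat.padicValuation 2 ((Nat.lcmUpto n : ℚ) ^ 2 * wC n) ≤ 1 ∧
        Rat.padicValuation 2 ((Nat.lcmUpto n : ℚ) ^ 5 * vC n) ≤ exp 1) :
    (∃ z : ℤ, uC n = z) ∧ (∃ z : ℤ, (Nat.lcmUpto n : ℚ) ^ 2 * wC n = z) ∧
      (∃ z : ℤ, 2 * (Nat.lcmUpto n : ℚ) ^ 5 * vC n = z) := by
  obtain ⟨hu, hw, hv⟩ := h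
  refine ⟨exists_int_of_forall_padicValuation_le_one fun r hr => ?_,
    exists_int_of_forall_padicValuation_le_one fun r hr => ?_,
    exists_int_of_forall_padicValuation_le_one fun r hr => ?_⟩
  · by_cases hr2 : r = 2
    · subst hr2; exact hu
    · exact @padicValuation_uC_le r ⟨hr⟩ hr2 n
  · by_cases hr2 : r = 2
    · subst hr2; exact hw
    · exact @padicValuation_lcmUpto_sq_mul_wC_le r ⟨hr⟩ hr2 n
  · haveI : Fact r.Prime := ⟨hr⟩
    by_cases hr2 : r = 2
    · subst hr2
      rw [mul_assoc, map_mul, show (2 : ℚ) = ((2 : ℕ) : ℚ) by norm_num, Rat.padicValuation_self]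
      calc exp (-1) * Rat.padicValuation 2 ((Nat.lcmUpto n : ℚ) ^ 5 * vC n) ≤ exp (-1) * exp 1 :=
          mul_le_mul' le_rfl hv
        _ = 1 := by rw [← exp_add, ← exp_zero]; norm_num
    · rw [mul_assoc, map_mul]
      exact mul_le_one' (by exact_mod_cast padicValuation_intCast_le_one r 2)
        (padicValuation_lcmUpto_pow_five_mul_vC_le hr2 n)

/-- **`Zudilin2002.integrality` from the global `r`-half inclusions** `uₙ ∈ ℤ`, `D_n²wₙ ∈ ℤ`, `2D_n⁵vₙ ∈ ℤ` (all `n`).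
[cite: Zudilin2002Zeta5, Sect. 1 (display before (6)) and Sect. 2 (14)–(15)] -/
theorem integrality_of_rHalf_int
    (h : ∀ n : ℕ, (∃ z : ℤ, uC n = z) ∧ (∃ z : ℤ, (Nat.lcmUpto n : ℚ) ^ 2 * wC n = z) ∧
      (∃ z : ℤ, 2 * (Nat.lcmUpto n : ℚ) ^ 5 * vC n = z)) :
    integrality :=
  integrality_of_rHalf_two_adic fun n => rHalf_two_adic_of_int (h n)

/-! ### The `r`-half inclusions ARE Krattenthaler–Rivoal's Théorème 1 for the kernel `(6,1,1)` -/

/-- **Krattenthaler–Rivoal's Théorème 1 at `(n, A, B, C, r) = (n, 6, 1, 0, 1)` gives `uₙ ∈ ℤ`, `D_n²wₙ ∈ ℤ`, `2D_n⁵vₙ ∈ ℤ`**: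
clause (i) at `l = 5` (`d_n⁰p_{5,n}(1) ∈ ℤ`) and `l = 3` (`d_n²p_{3,n}(1) ∈ ℤ`), clause (ii) at `C = 0`
(`2d_n⁵p_{0,0,n}(1) ∈ ℤ`), applied to the cells of the kernel `(6,1,1)` — which are partial-fraction data of `R_{n,6,1,1}`
(`isPartialFractionData_cell`) — with `p_{l,n}(1) = x_l(n)`, `p_{0,0,n}(1) = x_0(n)` and `uₙ = x_5(n)`, `wₙ = x_3(n)`,
`vₙ = −x_0(n)`.  CONDITIONAL on the named fact `KrattenthalerRivoal2007.theoreme1` (Mem. AMS 875 (2007), Théorème 1). -/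
theorem rHalf_int_of_theoreme1 (h : theoreme1) (n : ℕ) :
    (∃ z : ℤ, uC n = z) ∧ (∃ z : ℤ, (Nat.lcmUpto n : ℚ) ^ 2 * wC n = z) ∧
      (∃ z : ℤ, 2 * (Nat.lcmUpto n : ℚ) ^ 5 * vC n = z) := by
  have hc := isPartialFractionData_cell (A := 6) (B := 1) (by norm_num) (by norm_num) n
  obtain ⟨hl, z₀, hz₀⟩ := h n 6 1 0 1 (by norm_num) le_rfl (by norm_num) _ hc
  have h1 : ((-1 : ℚ)) ^ 6 = 1 := by norm_num
  obtain ⟨z₅, hz₅⟩ := hl 5 (by norm_num) (by norm_num)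
  obtain ⟨z₃, hz₃⟩ := hl 3 (by norm_num) (by norm_num)
  rw [h1, pCoeff_one_eq_xCoeff (by norm_num) (by norm_num) hc (by norm_num) (by norm_num)] at hz₅ hz₃
  rw [h1, pZero_one_eq_xZero (by norm_num) (by norm_num) hc] at hz₀
  refine ⟨⟨z₅, ?_⟩, ⟨z₃, ?_⟩, ⟨-z₀, ?_⟩⟩
  · rw [uC_eq_xCoeff, ← hz₅]; norm_num
  · rw [wC_eq_xCoeff, ← hz₃]
  · rw [vC_eq_neg_xZero, Int.cast_neg, ← hz₀]; ring

/-- **`KrattenthalerRivoal2007.theoreme1 → Zudilin2002.integrality`** (CONDITIONAL result: the named fact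
`4D_n²qₙ, 4D_n⁷pₙ, 4D_n⁵p̃ₙ ∈ ℤ` of Mat. Zametki 72 (2002) is a corollary of Krattenthaler–Rivoal's denominators theorem for
the single kernel `(6,1,1)`, the partner series `r̃ₙ` being handled by the cell's contiguity transport and the `2`-adic
margin `ord₂ b₀(n) ≤ 1`). [cite: Zudilin2002Zeta5, Sect. 1 (display before (6)) and Sect. 2 (14)–(15)] -/
theorem integrality_of_theoreme1 (h : theoreme1) : integrality :=
  integrality_of_rHalf_int fun n => rHalf_int_of_theoreme1 h n

/-! ### The same from Krattenthaler–Rivoal's `p`-adic refinement (Théorème 5) -/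

section theoreme5

open Literature.NumberTheory.Irrationality.KrattenthalerRivoal2007 (theoreme5 theoreme5.integral pCoeff pZero)
open Summit.KontsevichZagierPeriods.Zeta5Search.BrickLaurent (cell)

/-- The `r`-half inclusions from the CONCLUSION SHAPE of Krattenthaler–Rivoal's Théorème 1 at `(n, 6, 1, 0, 1)`, read on the
cells of the kernel `(6,1,1)`: if `d_n^{6−l−1}p_{l,n}(1) ∈ ℤ` for `1 ≤ l ≤ 5` and `2d_n⁵p_{0,0,n}(1) ∈ ℤ` (for the cell data),
then `uₙ ∈ ℤ`, `D_n²wₙ ∈ ℤ`, `2D_n⁵vₙ ∈ ℤ`.  (The bookkeeping of `rHalf_int_of_theoreme1`, separated from the named fact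
so that any source of these conclusions — Théorème 1, Théorème 5, or a future kernel proof at `p = 2` — feeds
`integrality_of_rHalf_int`.) -/
theorem rHalf_int_of_conclusions (n : ℕ)
    (hKR : (∀ l : ℕ, 1 ≤ l → l + 1 ≤ 6 →
        ∃ z : ℤ, ((Nat.lcmUpto n : ℕ) : ℚ) ^ (6 - l - 1) *
          pCoeff n (fun o K => cell 6 1 1 n K (o + 1)) l ((-1) ^ 6) = z) ∧
      ∃ z : ℤ, 2 * ((Nat.lcmUpto n : ℕ) : ℚ) ^ (6 + 0 - 1) *
        pZero n 6 0 (fun o K => cell 6 1 1 n K (o + 1)) ((-1) ^ 6) = z) :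
    (∃ z : ℤ, uC n = z) ∧ (∃ z : ℤ, (Nat.lcmUpto n : ℚ) ^ 2 * wC n = z) ∧
      (∃ z : ℤ, 2 * (Nat.lcmUpto n : ℚ) ^ 5 * vC n = z) := by
  have hc := isPartialFractionData_cell (A := 6) (B := 1) (by norm_num) (by norm_num) n
  obtain ⟨hl, z₀, hz₀⟩ := hKR
  have h1 : ((-1 : ℚ)) ^ 6 = 1 := by norm_num
  obtain ⟨z₅, hz₅⟩ := hl 5 (by norm_num) (by norm_num)
  obtain ⟨z₃, hz₃⟩ := hl 3 (by norm_num) (by norm_num)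
  rw [h1, pCoeff_one_eq_xCoeff (by norm_num) (by norm_num) hc (by norm_num) (by norm_num)] at hz₅ hz₃
  rw [h1, pZero_one_eq_xZero (by norm_num) (by norm_num) hc] at hz₀
  refine ⟨⟨z₅, ?_⟩, ⟨z₃, ?_⟩, ⟨-z₀, ?_⟩⟩
  · rw [uC_eq_xCoeff, ← hz₅]; norm_num
  · rw [wC_eq_xCoeff, ← hz₃]
  · rw [vC_eq_neg_xZero, Int.cast_neg, ← hz₀]; ring

/-- **`KrattenthalerRivoal2007.theoreme5 → Zudilin2002.integrality`** (CONDITIONAL result): Krattenthaler–Rivoal's `p`-adic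
refinement (Théorème 5: `Φ̃_n^{B−1}`-divisibility on top of the `d_n`-saving, `r = 1`) contains at `B = 1` (`Φ̃_n⁰ = 1`) the
conclusions of Théorème 1 for the kernel `(6,1,1)` (`theoreme5.integral`, proved in the Literature file), hence the three
`r`-half inclusions and, by `integrality_of_rHalf_int`, the named fact.  So EITHER of the two open Krattenthaler–Rivoal
named facts of `DenominatorsTheorem.lean` closes `Zudilin2002.integrality`.
[cite: Zudilin2002Zeta5, Sect. 1 (display before (6)) and Sect. 2 (14)–(15)] -/
theorem integrality_of_theoreme5 (h : theoreme5) : integrality :=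
  integrality_of_rHalf_int fun n => rHalf_int_of_conclusions n
    (theoreme5.integral h n 6 1 0 (by norm_num) le_rfl (by norm_num) _
      (isPartialFractionData_cell (A := 6) (B := 1) (by norm_num) (by norm_num) n))

end theoreme5

end Summit.KontsevichZagierPeriods.Zeta5Search.Zudilin2002IntegralityFromKR
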